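import Summits.Ventures.PercRepro.SixThreeProfileB
import Summits.Ventures.PercRepro.RankLevelSetHClose

/-!
# PercRepro — the type-`3` demand of a plane (mine-2 §19.7 Step 2, `C₂`) (p2, gen 6)

The demand of type `3` is `#{B ∈ R₃(G) : ρ(G ∖ B) = 3} = N₃ − C₂` with `C₂ = #{B ∈ R₃(G) : ρ(G ∖ B) ≤ 2}`.  Writing
`Z = G ∖ B`, the sets with `ρ(Z) ≤ 2` are `Z = ∅`, `Z = {a}` (with `ρ(G ∖ {a}) = 3`: `g′` of them) and `Z ⊆ ℓ ∩ G` with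
`|Z| ≥ 2` for a line `ℓ` of `M|G` (the line is determined by `Z`), each subject to `ρ(G ∖ Z) = 3`:

    C₂ ≥ 1 + g′ + Σ_ℓ #{Z ⊆ ℓ ∩ G : |Z| ≥ 2, ρ(G ∖ Z) = 3}                      (`card_low_ge`)

and for a line with `ρ(G ∖ ℓ) = 3` every `Z ⊆ ℓ ∩ G` qualifies, giving `2^{m_ℓ} − 1 − m_ℓ` (`card_good_eq_of_rank`).
For a plane that is not a union of two lines this is mine-2's `C₂ = 1 + g + Σ_{all lines} (2^{m_ℓ} − m_ℓ − 1)`.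
-/

namespace PercRepro

namespace SixThree

open Finset ThmH

variable {α : Type*} [DecidableEq α] {M : Matroid α} [M.Finite]

/-- The «low» sets: rank-`3` subsets `B` of `G` whose complement in `G` has rank `≤ 2`. -/
noncomputable def lowSets (M : Matroid α) [M.Finite] (G : Finset α) : Finset (Finset α) :=
  (R3 M G).filter (fun B : Finset α => ¬ M.eRk ((G \ B : Finset α) : Set α) = 3)

/-- The good subsets of a line trace: `Z ⊆ L ∩ G` with `|Z| ≥ 2` and `ρ(G ∖ Z) = 3`. -/
noncomputable def goodZ (M : Matroid α) [M.Finite] (G L : Finset α) : Finset (Finset α) :=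
  (L ∩ G).powerset.filter (fun Z : Finset α => 2 ≤ Z.card ∧ M.eRk ((G \ Z : Finset α) : Set α) = 3)

/-- The type-`3` demand is `N₃ − #lowSets`. -/
theorem card_demand3_add_low (G : Finset α) :
    ((R3 M G).filter (fun B : Finset α => M.eRk ((G \ B : Finset α) : Set α) = 3)).card + (lowSets M G).card =
      (R3 M G).card :=
  Finset.card_filter_add_card_filter_not (s := R3 M G) (p := fun B : Finset α => M.eRk ((G \ B : Finset α) : Set α) = 3)

/-- `G ∖ Z ∈ R₃(G)` when `ρ(G ∖ Z) = 3`. -/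
theorem sdiff_mem_R3 {G Z : Finset α} (h : M.eRk ((G \ Z : Finset α) : Set α) = 3) : G \ Z ∈ R3 M G := by
  unfold R3
  rw [Finset.mem_filter, Finset.mem_powerset]
  exact ⟨Finset.sdiff_subset, h⟩

/-- **The lower bound on `C₂`** (`g ≥ 4`): `#lowSets ≥ 1 + g′ + Σ_{L ∈ linesOf G} #goodZ(L)`. -/
theorem card_low_ge (hs : Simple M) {G : Finset α} (hG : G ∈ planes M) (hg4 : 4 ≤ G.card) :
    1 + (G.filter (fun a => M.eRk ((G.erase a : Finset α) : Set α) = 3)).card +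
      ∑ L ∈ linesOf M G, (goodZ M G L).card ≤ (lowSets M G).card := by
  classical
  have hGg : G ⊆ gr M := (mem_planes.1 hG).1
  have hG3 := (mem_planes.1 hG).2.2
  -- the three families, as images `Z ↦ G ∖ Z`
  set F0 : Finset (Finset α) := {G} with hF0
  set F1 : Finset (Finset α) := (G.filter (fun a => M.eRk ((G.erase a : Finset α) : Set α) = 3)).image
    (fun a => G.erase a) with hF1
  set F2 : Finset (Finset α) := ((linesOf M G).biUnion (fun L => goodZ M G L)).image (fun Z => G \ Z) with hF2
  -- all three lie in `lowSets`
  have hF0sub : F0 ⊆ lowSets M G := by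
    intro B hB
    rw [hF0, Finset.mem_singleton] at hB
    subst hB
    unfold lowSets
    rw [Finset.mem_filter]
    refine ⟨?_, ?_⟩
    · unfold R3
      rw [Finset.mem_filter, Finset.mem_powerset]
      exact ⟨Finset.Subset.refl _, hG3⟩
    rw [Finset.sdiff_self, Finset.coe_empty, M.eRk_empty]
    decide
  have hF1sub : F1 ⊆ lowSets M G := by
    intro B hB
    rw [hF1, Finset.mem_image] at hB
    obtain ⟨a, ha, rfl⟩ := hB
    rw [Finset.mem_filter] at ha
    unfold lowSets
    rw [Finset.mem_filter]
    refine ⟨?_, ?_⟩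
    · unfold R3
      rw [Finset.mem_filter, Finset.mem_powerset]
      exact ⟨Finset.erase_subset _ _, ha.2⟩
    · have : G \ G.erase a = {a} := by
        ext y
        rw [Finset.mem_sdiff, Finset.mem_erase, Finset.mem_singleton]
        constructor
        · rintro ⟨hyG, hy⟩
          by_contra hne
          exact hy ⟨hne, hyG⟩
        · rintro rfl
          exact ⟨ha.1, fun h => h.1 rfl⟩
      rw [this]
      have h1 := M.eRk_le_encard (({a} : Finset α) : Set α)
      rw [Set.encard_coe_eq_coe_finsetCard, Finset.card_singleton] at h1
      intro h3
      rw [h3] at h1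
      exact absurd h1 (by decide)
  have hF2sub : F2 ⊆ lowSets M G := by
    intro B hB
    rw [hF2, Finset.mem_image] at hB
    obtain ⟨Z, hZ, rfl⟩ := hB
    rw [Finset.mem_biUnion] at hZ
    obtain ⟨L, hL, hZ⟩ := hZ
    unfold goodZ at hZ
    rw [Finset.mem_filter, Finset.mem_powerset] at hZ
    unfold lowSets
    rw [Finset.mem_filter]
    refine ⟨sdiff_mem_R3 hZ.2.2, ?_⟩
    have hZsub : Z ⊆ L := hZ.1.trans Finset.inter_subset_left
    have hZG : Z ⊆ G := hZ.1.trans Finset.inter_subset_right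
    have : G \ (G \ Z) = Z := Finset.sdiff_sdiff_eq_self hZG
    rw [this]
    intro h3
    have := M.eRk_mono (Finset.coe_subset.2 hZsub)
    rw [h3, (mem_lines.1 (Finset.mem_filter.1 hL).1).2.2] at this
    exact absurd this (by decide)
  -- cardinalities of the families
  have hF1card : F1.card = (G.filter (fun a => M.eRk ((G.erase a : Finset α) : Set α) = 3)).card := by
    rw [hF1]
    apply Finset.card_image_of_injOn
    intro a ha b hb hab
    simp only at hab
    have haG : a ∈ G := (Finset.mem_filter.1 ha).1
    have hbG : b ∈ G := (Finset.mem_filter.1 hb).1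
    by_contra hne
    have : b ∈ G.erase a := Finset.mem_erase.2 ⟨Ne.symm hne, hbG⟩
    rw [hab] at this
    exact (Finset.mem_erase.1 this).1 rfl
  have hF2card : F2.card = ∑ L ∈ linesOf M G, (goodZ M G L).card := by
    rw [hF2, Finset.card_image_of_injOn, Finset.card_biUnion]
    · intro L hL L' hL' hne
      simp only [Function.onFun]
      rw [Finset.disjoint_left]
      intro Z hZ hZ'
      unfold goodZ at hZ hZ'
      rw [Finset.mem_filter, Finset.mem_powerset] at hZ hZ'
      -- `Z` has two points, on both `L` and `L'`
      obtain ⟨u, hu, v, hv, huv⟩ := Finset.one_lt_card.1 hZ.2.1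
      exact hne (lines_eq_of_two_mem hs (Finset.mem_filter.1 hL).1 (Finset.mem_filter.1 hL').1
        (Finset.mem_inter.1 (hZ.1 hu)).1 (Finset.mem_inter.1 (hZ.1 hv)).1
        (Finset.mem_inter.1 (hZ'.1 hu)).1 (Finset.mem_inter.1 (hZ'.1 hv)).1 huv)
    · intro Z hZ Z' hZ' h
      simp only at h
      rw [Finset.mem_coe, Finset.mem_biUnion] at hZ hZ'
      obtain ⟨L, -, hZ⟩ := hZ
      obtain ⟨L', -, hZ'⟩ := hZ'
      unfold goodZ at hZ hZ'
      rw [Finset.mem_filter, Finset.mem_powerset] at hZ hZ'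
      have hZG : Z ⊆ G := hZ.1.trans Finset.inter_subset_right
      have hZ'G : Z' ⊆ G := hZ'.1.trans Finset.inter_subset_right
      rw [← Finset.sdiff_sdiff_eq_self hZG, ← Finset.sdiff_sdiff_eq_self hZ'G, h]
  -- the families are pairwise disjoint (sizes `g`, `g − 1`, `≤ g − 2`)
  have hcardF1 : ∀ B ∈ F1, B.card = G.card - 1 := by
    intro B hB
    rw [hF1, Finset.mem_image] at hB
    obtain ⟨a, ha, rfl⟩ := hB
    exact Finset.card_erase_of_mem (Finset.mem_filter.1 ha).1
  have hcardF2 : ∀ B ∈ F2, B.card + 2 ≤ G.card := by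
    intro B hB
    rw [hF2, Finset.mem_image] at hB
    obtain ⟨Z, hZ, rfl⟩ := hB
    rw [Finset.mem_biUnion] at hZ
    obtain ⟨L, -, hZ⟩ := hZ
    unfold goodZ at hZ
    rw [Finset.mem_filter, Finset.mem_powerset] at hZ
    have hZG : Z ⊆ G := hZ.1.trans Finset.inter_subset_right
    have := Finset.card_sdiff_of_subset hZG
    omega
  have hd01 : Disjoint F0 F1 := by
    rw [Finset.disjoint_left]
    intro B hB0 hB1
    rw [hF0, Finset.mem_singleton] at hB0
    have := hcardF1 B hB1
    rw [hB0] at this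
    omega
  have hd02 : Disjoint (F0 ∪ F1) F2 := by
    rw [Finset.disjoint_left]
    intro B hB hB2
    have h2 := hcardF2 B hB2
    rw [Finset.mem_union] at hB
    rcases hB with hB0 | hB1
    · rw [hF0, Finset.mem_singleton] at hB0
      rw [hB0] at h2
      omega
    · have := hcardF1 B hB1
      omega
  have hsub : F0 ∪ F1 ∪ F2 ⊆ lowSets M G :=
    Finset.union_subset (Finset.union_subset hF0sub hF1sub) hF2sub
  have := Finset.card_le_card hsub
  rw [Finset.card_union_of_disjoint hd02, Finset.card_union_of_disjoint hd01, hF1card, hF2card] at this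
  simpa [hF0] using this

/-- For a line `L` with `ρ(G ∖ L) = 3`, every `Z ⊆ L ∩ G` with `|Z| ≥ 2` is good: `#goodZ(L) + m + 1 = 2^m`,
`m = |L ∩ G|`. -/
theorem card_goodZ_of_rank {G L : Finset α} (hG : G ∈ planes M)
    (hr : M.eRk ((G \ L : Finset α) : Set α) = 3) :
    (goodZ M G L).card + (L ∩ G).card + 1 = 2 ^ (L ∩ G).card := by
  have hG3 := (mem_planes.1 hG).2.2
  have heq : goodZ M G L = (L ∩ G).powerset.filter (fun Z : Finset α => 2 ≤ Z.card) := by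
    unfold goodZ
    apply Finset.filter_congr
    intro Z hZ
    rw [Finset.mem_powerset] at hZ
    constructor
    · exact fun h => h.1
    · intro h2
      refine ⟨h2, ?_⟩
      apply le_antisymm
      · rw [← hG3]; exact M.eRk_mono (Finset.coe_subset.2 Finset.sdiff_subset)
      · rw [← hr]
        apply M.eRk_mono (Finset.coe_subset.2 _)
        intro y hy
        rw [Finset.mem_sdiff] at hy ⊢
        exact ⟨hy.1, fun hyZ => hy.2 (Finset.mem_inter.1 (hZ hyZ)).1⟩
  rw [heq]
  exact card_ge_two_add (L ∩ G)

/-- mine-2's `C₂` for a plane that is not a union of two lines: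
`1 + g + Σ_{m ∈ P} (2^m − 1 − m) + (C(g, 2) − Σ_{m ∈ P} C(m, 2))` (the last term counts the `2`-point lines). -/
def C2gen (g : ℕ) (P : Multiset ℕ) : ℕ :=
  1 + g + (Multiset.map (fun m => 2 ^ m - 1 - m) P).sum + (g.choose 2 - (Multiset.map (fun m => m.choose 2) P).sum)

/-- `Σ_{L ∈ linesOf G} (2^{m_L} − 1 − m_L) = Σ_{m ∈ prof} (2^m − 1 − m) + #{2-point lines}`, and
`#{2-point lines} + Σ_{m ∈ prof} C(m, 2) = C(g, 2)`. -/
theorem sum_lines_pow_eq (hs : Simple M) {G : Finset α} (hG : G ∈ planes M) :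
    ∑ L ∈ linesOf M G, (2 ^ (L ∩ G).card - 1 - (L ∩ G).card) =
      (Multiset.map (fun m => 2 ^ m - 1 - m) (prof M G)).sum +
        (G.card.choose 2 - (Multiset.map (fun m => m.choose 2) (prof M G)).sum) := by
  classical
  have hGg : G ⊆ gr M := (mem_planes.1 hG).1
  -- split the lines into big (`≥ 3` points) and `2`-point lines
  have hsplit := Finset.sum_filter_add_sum_filter_not (linesOf M G) (fun L => 3 ≤ (L ∩ G).card)
    (fun L => 2 ^ (L ∩ G).card - 1 - (L ∩ G).card)
  have h2 : ∀ L ∈ (linesOf M G).filter (fun L => ¬ 3 ≤ (L ∩ G).card), (L ∩ G).card = 2 := by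
    intro L hL
    rw [Finset.mem_filter] at hL
    have := (Finset.mem_filter.1 hL.1).2
    omega
  have hA : ∑ L ∈ (linesOf M G).filter (fun L => 3 ≤ (L ∩ G).card), (2 ^ (L ∩ G).card - 1 - (L ∩ G).card) =
      (Multiset.map (fun m => 2 ^ m - 1 - m) (prof M G)).sum := by
    unfold prof
    rw [Multiset.map_map]
    rfl
  have hB : ∑ L ∈ (linesOf M G).filter (fun L => ¬ 3 ≤ (L ∩ G).card), (2 ^ (L ∩ G).card - 1 - (L ∩ G).card) =
      ((linesOf M G).filter (fun L => ¬ 3 ≤ (L ∩ G).card)).card := by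
    rw [Finset.card_eq_sum_ones]
    apply Finset.sum_congr rfl
    intro L hL
    rw [h2 L hL]
    norm_num
  -- the `2`-point lines are counted by the pair identity
  have hpairs := sum_choose_linesOf hs hGg
  have hsplit2 := Finset.sum_filter_add_sum_filter_not (linesOf M G) (fun L => 3 ≤ (L ∩ G).card)
    (fun L => ((L ∩ G).card).choose 2)
  have hC : ∑ L ∈ (linesOf M G).filter (fun L => 3 ≤ (L ∩ G).card), ((L ∩ G).card).choose 2 =
      (Multiset.map (fun m => m.choose 2) (prof M G)).sum := by
    unfold prof
    rw [Multiset.map_map]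
    rfl
  have hD : ∑ L ∈ (linesOf M G).filter (fun L => ¬ 3 ≤ (L ∩ G).card), ((L ∩ G).card).choose 2 =
      ((linesOf M G).filter (fun L => ¬ 3 ≤ (L ∩ G).card)).card := by
    rw [Finset.card_eq_sum_ones]
    apply Finset.sum_congr rfl
    intro L hL
    rw [h2 L hL]
    rfl
  rw [hC, hD, hpairs] at hsplit2
  rw [← hsplit, hA, hB]
  omega

/-- **The type-`3` demand of a plane that is not a union of two lines** (`g ≥ 4`, every line has `ρ(G ∖ L) = 3`):
`#{B ∈ R₃ : ρ(G ∖ B) = 3} + C2gen g (prof G) ≤ N₃`. -/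
theorem demand3_le_general (hs : Simple M) {G : Finset α} (hG : G ∈ planes M) (hg4 : 4 ≤ G.card)
    (hnot : ∀ L ∈ linesOf M G, M.eRk ((G \ L : Finset α) : Set α) = 3) :
    ((R3 M G).filter (fun B : Finset α => M.eRk ((G \ B : Finset α) : Set α) = 3)).card +
      C2gen G.card (prof M G) ≤ (R3 M G).card := by
  have hlow := card_low_ge hs hG hg4
  have hsum : ∑ L ∈ linesOf M G, (goodZ M G L).card =
      ∑ L ∈ linesOf M G, (2 ^ (L ∩ G).card - 1 - (L ∩ G).card) := by
    apply Finset.sum_congr rfl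
    intro L hL
    have := card_goodZ_of_rank hG (hnot L hL)
    omega
  rw [hsum, sum_lines_pow_eq hs hG] at hlow
  -- `g′ ≥ g`: no line through `g − 1` points (its complement would have rank `1`)
  have hg' : G.card ≤ (G.filter (fun a => M.eRk ((G.erase a : Finset α) : Set α) = 3)).card := by
    have h := gprime_ge hs hG hg4
    have hnotmem : G.card - 1 ∉ prof M G := by
      intro hmem
      unfold prof at hmem
      rw [Multiset.mem_map] at hmem
      obtain ⟨L, hL, hLc⟩ := hmem
      rw [Finset.mem_val, Finset.mem_filter] at hL
      have hr := hnot L hL.1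
      have h1 : (G \ L).card = 1 := by
        have h := Finset.card_sdiff_add_card_inter G L
        rw [Finset.inter_comm, hLc] at h
        omega
      have := M.eRk_le_encard ((G \ L : Finset α) : Set α)
      rw [hr, Set.encard_coe_eq_coe_finsetCard, h1] at this
      exact absurd this (by decide)
    rw [if_neg hnotmem] at h
    omega
  have := card_demand3_add_low (M := M) G
  unfold C2gen
  omega

/-! ### Line + point and the bad-`Z` form -/

/-- **Line + point**: a line through `g − 1` points of `G` makes the type-`3` demand `0` (every rank-`3` subset contains
the extra point, so its complement in `G` lies on the line). -/
theorem demand3_eq_zero_of_line_point {G L : Finset α} (hG : G ∈ planes M)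
    (hL : L ∈ linesOf M G) (hk : (L ∩ G).card = G.card - 1) :
    ((R3 M G).filter (fun B : Finset α => M.eRk ((G \ B : Finset α) : Set α) = 3)).card = 0 := by
  rw [Finset.card_eq_zero, Finset.filter_eq_empty_iff]
  intro B hB h3
  unfold R3 at hB
  rw [Finset.mem_filter, Finset.mem_powerset] at hB
  have hL' : L ∈ lines M := (Finset.mem_filter.1 hL).1
  -- the point off the line
  have hoff : (G \ L).card = 1 := by
    have h := Finset.card_sdiff_add_card_inter G L
    rw [Finset.inter_comm, hk] at h
    have : 1 ≤ G.card := by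
      have := three_le_card_of_eRk_eq_three (mem_planes.1 hG).2.2
      omega
    omega
  obtain ⟨p, hp⟩ := Finset.card_eq_one.1 hoff
  -- `p ∈ B` (else `B ⊆ L`, rank `≤ 2`)
  have hpB : p ∈ B := by
    by_contra hpB
    have hBL : B ⊆ L := by
      intro y hy
      by_contra hyL
      have : y ∈ G \ L := Finset.mem_sdiff.2 ⟨hB.1 hy, hyL⟩
      rw [hp, Finset.mem_singleton] at this
      exact hpB (this ▸ hy)
    have := M.eRk_mono (Finset.coe_subset.2 hBL)
    rw [hB.2, (mem_lines.1 hL').2.2] at this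
    exact absurd this (by decide)
  -- so `G ∖ B ⊆ L`, of rank `≤ 2`
  have hsub : G \ B ⊆ L := by
    intro y hy
    rw [Finset.mem_sdiff] at hy
    by_contra hyL
    have : y ∈ G \ L := Finset.mem_sdiff.2 ⟨hy.1, hyL⟩
    rw [hp, Finset.mem_singleton] at this
    exact hy.2 (this ▸ hpB)
  have := M.eRk_mono (Finset.coe_subset.2 hsub)
  rw [h3, (mem_lines.1 hL').2.2] at this
  exact absurd this (by decide)

/-- The bad subsets of a line trace: `Z ⊆ L ∩ G`, `|Z| ≥ 2`, `ρ(G ∖ Z) ≠ 3`. -/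
noncomputable def badZ (M : Matroid α) [M.Finite] (G L : Finset α) : Finset (Finset α) :=
  (L ∩ G).powerset.filter (fun Z : Finset α => 2 ≤ Z.card ∧ ¬ M.eRk ((G \ Z : Finset α) : Set α) = 3)

/-- `#goodZ + #badZ + m + 1 = 2^m`. -/
theorem card_goodZ_add_badZ (G L : Finset α) :
    (goodZ M G L).card + (badZ M G L).card + (L ∩ G).card + 1 = 2 ^ (L ∩ G).card := by
  have h := card_ge_two_add (L ∩ G)
  have hsplit := Finset.card_filter_add_card_filter_not (s := (L ∩ G).powerset.filter (fun Z : Finset α => 2 ≤ Z.card))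
    (p := fun Z : Finset α => M.eRk ((G \ Z : Finset α) : Set α) = 3)
  rw [Finset.filter_filter, Finset.filter_filter] at hsplit
  unfold goodZ badZ
  omega

/-- **The type-`3` demand with the bad-`Z` correction** (`g ≥ 4`, no line through `g − 1` points):
`demand₃ + C2gen g (prof G) ≤ N₃ + Σ_L #badZ(L)`. -/
theorem demand3_add_C2gen_le (hs : Simple M) {G : Finset α} (hG : G ∈ planes M) (hg4 : 4 ≤ G.card)
    (hnl : ∀ L ∈ linesOf M G, (L ∩ G).card ≠ G.card - 1) :
    ((R3 M G).filter (fun B : Finset α => M.eRk ((G \ B : Finset α) : Set α) = 3)).card +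
      C2gen G.card (prof M G) ≤ (R3 M G).card + ∑ L ∈ linesOf M G, (badZ M G L).card := by
  have hlow := card_low_ge hs hG hg4
  have hsum : ∑ L ∈ linesOf M G, (goodZ M G L).card + ∑ L ∈ linesOf M G, (badZ M G L).card =
      ∑ L ∈ linesOf M G, (2 ^ (L ∩ G).card - 1 - (L ∩ G).card) := by
    rw [← Finset.sum_add_distrib]
    apply Finset.sum_congr rfl
    intro L _
    have := card_goodZ_add_badZ (M := M) G L
    omega
  rw [sum_lines_pow_eq hs hG] at hsum
  have hg' : G.card ≤ (G.filter (fun a => M.eRk ((G.erase a : Finset α) : Set α) = 3)).card := by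
    have h := gprime_ge hs hG hg4
    have hnotmem : G.card - 1 ∉ prof M G := by
      intro hmem
      unfold prof at hmem
      rw [Multiset.mem_map] at hmem
      obtain ⟨L, hL, hLc⟩ := hmem
      rw [Finset.mem_val, Finset.mem_filter] at hL
      exact hnl L hL.1 hLc
    rw [if_neg hnotmem] at h
    omega
  have := card_demand3_add_low (M := M) G
  unfold C2gen
  omega

end SixThree

end PercRepro
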